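import Mathlib
import Literature.NumberTheory.LFunctions.Zhang2022.Section10Range1321MidTerm
import Literature.NumberTheory.LFunctions.Zhang2022.Section10Range1321MidScalars
import HarnessLib

/-!
# Zhang (2022) §10, `Θ₁(𝐚₁₃,𝐚₂₁)`: the middle range `P^{0.5} ≤ dr < P^{0.502}` — node
# `Z22:§10.u043` (first line) as a kernel EDGE from Lemmas 10.1 and 8.4

Topic `Literature/NumberTheory/LFunctions/Zhang2022` (Landau–Siegel audit tree; verdict-neutral).
Y. Zhang, *Discrete mean estimates and the Landau–Siegel zero*, arXiv:2211.02515v1 (2022)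
[Zhang2022LandauSiegel], §10 p. 58, tex L2986–L2990 — **an unrefereed manuscript under
adjudication; nothing here bears on its Theorems 1–2.**

> "By Lemma 10.1 and the results in Section 8, … the sum over `P^{0.5} ≤ dr < P^{0.502}` is equal to
> `(500L′(1,χ)²/(0.504 log²P)) Σ_{P^{0.5}≤n<P^{0.502}} |χ(n)|λ₀ⱼ(n)φ(n)⁻¹(−1 − β_j log(n/P^{0.5}))𝔤_{j6}(P^{0.504}/n) + o(α)`"

**`eq1043a_of : Skeleton.Lemma101 c′ → Skeleton.Lemma84 c′ → Typed.Sec10B.Eq1043a c′`.** The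
deduction, made explicit: the `m`-sum is `𝔳₁ⱼ(dr)` (Lemma 10.1: (10.3) on `(P^{0.5}, P^{0.502}/T]`,
(10.5) on the boundary point `P^{0.5}` and the window `(P^{0.502}/T, P^{0.502})`); the `n`-sum is
`(log P₁)⁻¹ ×` Lemma 8.4's sum at `x = P₁/(dr)`, `μ = 6` (`ϰ₂(drn) = 0`; `T < x < P`, `dr < PT⁻²`);
the `(d,r) ↦ n = dr` collapse is (8.10) (`Section10Range1321MidExact`); the per-`n` product
estimate and the window weights `Σ(n/φ(n))⁷/n` are `Section10Range1321MidTerm`, the scalar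
bookkeeping `Section10Range1321MidScalars`; with
`|L′(1,χ)| ≤ 𝓛³`, `|𝔤_{j6}| ≤ 146`, `|λ₀ⱼ(n)| ≤ (n/φ(n))⁴`, `|Π(d,r)| ≤ (dr/φ(dr))²` the total
error is `≤ 4e^{256}(K_g + K_e)𝓛⁻¹⁰ = o(α)` (`α = π𝓛⁻⁹`), `K_g, K_e` explicit in the constants of
Lemmas 10.1/8.4. Antecedents: the CLAIM nodes `Lemma101`, `Lemma84` (leaves of the cone); no
named fact.

## References

* Y. Zhang, arXiv:2211.02515v1 (2022), §10 p. 58; Lemma 10.1; §8 Lemma 8.4, (8.10).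
  [cite: Zhang2022LandauSiegel, §10 p. 58]
-/

noncomputable section

open Complex Real Finset ComplexConjugate

namespace Literature.NumberTheory.LFunctions.Zhang2022.Sj1321Mid

open Skeleton Typed.Sec10B

/-- `P > 0`. [cite: Zhang2022LandauSiegel, §2 (2.6)] -/
private theorem bigP_pos₄ (D : ℕ) : 0 < bigP D := Real.exp_pos _

/-- The threshold: `D ≥ ⌈e^{L₀}⌉ ⇒ 𝓛 ≥ L₀`. [cite: Zhang2022LandauSiegel, §2 p. 4] -/
private theorem le_ell_of_ceil_exp_le₄ {L₀ : ℝ} {D : ℕ} (hD : ⌈Real.exp L₀⌉₊ ≤ D) :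
    L₀ ≤ ell D := by
  have h1 : Real.exp L₀ ≤ (D : ℝ) := le_trans (Nat.le_ceil _) (by exact_mod_cast hD)
  have h2 := Real.log_le_log (Real.exp_pos _) h1
  rwa [Real.log_exp] at h2

/-! ## The edge `Lemma101 → Lemma84 → Eq1043a` -/

/-- **`Z22:§10.u043` (first line) from Lemmas 10.1 and 8.4**: the middle-range evaluation
`Typed.Sec10B.Eq1043a c′` holds whenever the CLAIM nodes `Skeleton.Lemma101 c′` (Lemma 10.1) and
`Skeleton.Lemma84 c′` (Lemma 8.4) hold — the manuscript's "By Lemma 10.1 and the results in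
Section 8" for the range `P^{0.5} ≤ dr < P^{0.502}`, with every implicit estimate made explicit
(error `≤ 4e^{256}(K_g + K_e)𝓛⁻¹⁰ ≤ εα` for `𝓛 ≥ 4e^{256}(K_g+K_e)/(επ) + 1`, `𝓛 ≥ 200`,
`𝓛 ≥ 5π|c′| + 1`). [cite: Zhang2022LandauSiegel, §10 p. 58] -/
theorem eq1043a_of (c' : ℝ) (h101 : Lemma101 c') (h84 : Lemma84 c') : Eq1043a c' := by
  obtain ⟨c₁, -, C₁, D₁, h₁⟩ := h101
  obtain ⟨C₂, D₂, h₂⟩ := h84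
  intro ε hε
  -- constants
  set Kg : ℝ := |C₁| * (|C₂| + 146) + 1000 * |C₂| with hKg
  set Ke : ℝ := (|C₁| + 1000) * (|C₂| + 146) + 1000 * |C₂| with hKe
  have hKg0 : 0 ≤ Kg := by positivity
  have hKe0 : 0 ≤ Ke := by positivity
  set L₀ : ℝ := max 200 (max (5 * π * |c'| + 1) (4 * Real.exp 256 * (Kg + Ke) / (ε * π) + 1))
    with hL₀
  refine ⟨max (max D₁ D₂) ⌈Real.exp L₀⌉₊, fun D _ χ hD hq hp hA j hj => ?_⟩
  -- thresholds
  have hD₁ : D₁ ≤ D := le_trans (le_trans (le_max_left _ _) (le_max_left _ _)) hD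
  have hD₂ : D₂ ≤ D := le_trans (le_trans (le_max_right _ _) (le_max_left _ _)) hD
  have hL : L₀ ≤ ell D := le_ell_of_ceil_exp_le₄ (le_trans (le_max_right _ _) hD)
  have hL200 : 200 ≤ ell D := le_trans (le_max_left _ _) hL
  have hLc : 5 * π * |c'| + 1 ≤ ell D :=
    le_trans (le_trans (le_max_left _ _) (le_max_right _ _)) hL
  have hLK : 4 * Real.exp 256 * (Kg + Ke) / (ε * π) + 1 ≤ ell D :=
    le_trans (le_trans (le_max_right _ _) (le_max_right _ _)) hL
  have hL3 : 3 ≤ ell D := by linarith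
  have hLpos : 0 < ell D := by linarith
  have hL1 : 1 ≤ ell D := by linarith
  -- `α = π𝓛⁻⁹` and the `c′`-condition of the `β`-bounds
  have hα : alpha D = π / ell D ^ 9 := by rw [alpha, bigP, Real.log_exp]
  have hc : 5 * |c'| * alpha D * ell D ≤ 1 := by
    rw [hα]
    have h8 : ell D ≤ ell D ^ 8 := le_self_pow₀ hL1 (by norm_num)
    have h1 : 5 * |c'| * (π / ell D ^ 9) * ell D = 5 * π * |c'| / ell D ^ 8 := by
      field_simp
    rw [h1, div_le_one (by positivity)]
    nlinarith [Real.pi_pos, abs_nonneg c']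
  -- the two lemmas at this `D, χ, j`
  have h₁' := h₁ D χ hD₁ hq hp hA j hj
  have h₂' := h₂ D χ hD₂ hq hp hA j hj 6 (by simp)
  have hL' : ‖deriv χ.LFunction 1‖ ≤ ell D ^ 3 := norm_derivL_one_le_cube χ hp hL200
  -- positivity of the basic parameters
  have hP : 0 < bigP D := bigP_pos₄ D
  have hP5 : 0 < bigP D ^ (0.5 : ℝ) := Real.rpow_pos_of_pos hP _
  have hP2 : 0 < bigP D ^ (0.502 : ℝ) := Real.rpow_pos_of_pos hP _
  have hT1 : 1 < bigT D := by
    have h11 : 0 < ell D ^ (1.1 : ℝ) := Real.rpow_pos_of_pos hLpos _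
    have := Real.add_one_lt_exp h11.ne'
    rw [Skeleton.bigT]; linarith
  have hT0 : 0 < bigT D := by linarith
  have hlP1 : Real.log (Skeleton.P1 D) = 0.504 * ell D ^ 9 := by
    rw [Skeleton.P1, Real.log_rpow hP, bigP, Real.log_exp]
  have hlP1pos : 0 < Real.log (Skeleton.P1 D) := by rw [hlP1]; positivity
  -- the exact layer
  rw [drSum_sub_main_eq c' χ hq hL3 j]
  -- abbreviations
  set e₂ : ℝ := |C₂| * (ell D ^ 6)⁻¹ with he₂
  set A : ℝ := 1000 * ell D ^ 3 / ell D ^ 9 with hAdef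
  set Bg : ℝ := (|C₁| * (ell D ^ 15)⁻¹ * (e₂ + 146 * ell D ^ 3) + A * e₂) /
    Real.log (Skeleton.P1 D) with hBg
  set Be : ℝ := ((|C₁| * (ell D ^ 7)⁻¹ + A) * (e₂ + 146 * ell D ^ 3) + A * e₂) /
    Real.log (Skeleton.P1 D) with hBe
  have he₂0 : 0 ≤ e₂ := by positivity
  have hA0 : 0 ≤ A := by positivity
  have hBg0 : 0 ≤ Bg := by positivity
  have hBe0 : 0 ≤ Be := by positivity
  set good : ℕ → Prop := fun n => bigP D ^ (0.5 : ℝ) < (n : ℝ) ∧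
    (n : ℝ) ≤ bigP D ^ (0.502 : ℝ) / bigT D with hgood
  -- **the per-`n` bound**
  have key : ∀ n ∈ (Finset.Ico 1 (Nsupp D)).filter
      (fun n : ℕ => bigP D ^ (0.5 : ℝ) ≤ (n : ℝ) ∧ (n : ℝ) < bigP D ^ (0.502 : ℝ)),
      ‖∑ r ∈ n.divisors, drWeight c' χ j (n / r) r *
          (mSum13 c' χ j n * nSum21 c' χ j (n / r) r -
            (500 * deriv χ.LFunction 1 / Real.log (bigP D) *
                (-1 - betaJ c' D j * (Real.log (n / bigP D ^ (0.5 : ℝ)) : ℂ))) *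
              (deriv χ.LFunction 1 * PiW χ (n / r) r *
                frakgW c' D j 6 (Skeleton.P1 D / (n : ℝ)) / (Real.log (Skeleton.P1 D) : ℂ)))‖ ≤
        ((n : ℝ) / Nat.totient n) ^ 7 / n * (if good n then Bg else Be) := by
    intro n hn
    rw [Finset.mem_filter, Finset.mem_Ico] at hn
    obtain ⟨⟨hn1, -⟩, hlo, hhi⟩ := hn
    have hn0 : n ≠ 0 := by omega
    obtain ⟨hx1, hx4, hTx, hxP, hnT⟩ := midRange_facts hL3 hlo hhi
    -- sizes of the main values
    have hg : ‖frakgW c' D j 6 (Skeleton.P1 D / (n : ℝ))‖ ≤ 146 :=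
      norm_frakgW_six_le c' hLpos hc j hx1 hx4
    have hm₁ : ‖500 * deriv χ.LFunction 1 / Real.log (bigP D) *
        (-1 - betaJ c' D j * (Real.log (n / bigP D ^ (0.5 : ℝ)) : ℂ))‖ ≤ A := by
      refine (norm_mainV1_le c' χ hLpos hc j hlo hhi.le).trans ?_
      rw [hAdef]
      gcongr
    -- the `n`-sums: Lemma 8.4 at `x = P₁/n`, `(d, r) = (n/r, r)`
    have hN : ∀ r ∈ n.divisors, nSum21 c' χ j (n / r) r =
        (1 / (Real.log (Skeleton.P1 D) : ℂ)) *
          ∑ m ∈ Finset.Ico 1 ⌈Skeleton.P1 D / (n : ℝ)⌉₊,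
            χ (m : ZMod D) * xiZero c' D j m (n / r) r / (m : ℂ) *
              (((Skeleton.P1 D / (n : ℝ)) / m : ℝ) : ℂ) ^ (-betaMu D 6) *
              (Real.log ((Skeleton.P1 D / (n : ℝ)) / m) : ℂ) := by
      intro r hr
      have hrn : n / r * r = n := Nat.div_mul_cancel (Nat.dvd_of_mem_divisors hr)
      have hd1 : 1 ≤ n / r := Nat.div_pos (Nat.divisor_le hr) (Nat.pos_of_mem_divisors hr)
      have hr1 : 1 ≤ r := Nat.pos_of_mem_divisors hr
      have hlo' : bigP D ^ (0.5 : ℝ) ≤ ((n / r * r : ℕ) : ℝ) := by rw [hrn]; exact hlo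
      have h := nSum21_eq c' χ hL3 j hd1 hr1 hlo'
      rw [hrn] at h
      exact h
    have h2 : ∀ r ∈ n.divisors,
        ‖(∑ m ∈ Finset.Ico 1 ⌈Skeleton.P1 D / (n : ℝ)⌉₊,
            χ (m : ZMod D) * xiZero c' D j m (n / r) r / (m : ℂ) *
              (((Skeleton.P1 D / (n : ℝ)) / m : ℝ) : ℂ) ^ (-betaMu D 6) *
              (Real.log ((Skeleton.P1 D / (n : ℝ)) / m) : ℂ)) -
          deriv χ.LFunction 1 * PiW χ (n / r) r * frakgW c' D j 6 (Skeleton.P1 D / (n : ℝ))‖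
          ≤ e₂ := by
      intro r hr
      have hrn : n / r * r = n := Nat.div_mul_cancel (Nat.dvd_of_mem_divisors hr)
      have hd1 : 1 ≤ n / r := Nat.div_pos (Nat.divisor_le hr) (Nat.pos_of_mem_divisors hr)
      have hr1 : 1 ≤ r := Nat.pos_of_mem_divisors hr
      have hdrT : ((n / r * r : ℕ) : ℝ) < bigP D / bigT D ^ 2 := by rw [hrn]; exact hnT
      have h := h₂' (n / r) r hd1 hr1 hdrT (Skeleton.P1 D / (n : ℝ)) hTx hxP
      refine h.trans ?_
      rw [he₂]
      exact mul_le_mul_of_nonneg_right (le_abs_self _) (by positivity)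
    -- the `m`-sum: Lemma 10.1, by cases on the position of `n`
    by_cases hgn : good n
    · rw [if_pos hgn]
      have h1 : ‖mSum13 c' χ j n - 500 * deriv χ.LFunction 1 / Real.log (bigP D) *
          (-1 - betaJ c' D j * (Real.log (n / bigP D ^ (0.5 : ℝ)) : ℂ))‖ ≤
          |C₁| * (ell D ^ 15)⁻¹ := by
        rw [mSum13_eq_frakv1 c' χ hL3 j hlo]
        refine ((h₁' n).2.1 hgn.1 hgn.2).trans ?_
        exact mul_le_mul_of_nonneg_right (le_abs_self _) (by positivity)
      have := norm_sum_divisors_le c' χ j hn0 (mSum13 c' χ j n) _ _ _ he₂0 (by positivity)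
        hlP1pos h1 hm₁ hg hL' hN h2
      rw [hBg]
      exact this
    · rw [if_neg hgn]
      -- edge: `|𝔳₁ⱼ(n)| ≤ C₁𝓛⁻⁷` by (10.5), and `|M − m₁| ≤ |M| + |m₁|`
      have hwin : (bigP D ^ (0.5 : ℝ) / bigT D < (n : ℝ) ∧ (n : ℝ) ≤ bigP D ^ (0.5 : ℝ)) ∨
          (bigP D ^ (0.502 : ℝ) / bigT D < (n : ℝ) ∧ (n : ℝ) ≤ bigP D ^ (0.502 : ℝ)) ∨
          (bigP D ^ (0.504 : ℝ) / bigT D < (n : ℝ) ∧ (n : ℝ) < bigP D ^ (0.504 : ℝ)) := by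
        rw [hgood] at hgn
        rcases not_and_or.mp hgn with h | h
        · left
          refine ⟨?_, not_lt.mp h⟩
          have : bigP D ^ (0.5 : ℝ) / bigT D < bigP D ^ (0.5 : ℝ) := div_lt_self hP5 hT1
          linarith
        · right; left
          exact ⟨not_le.mp h, hhi.le⟩
      have hv : ‖frakv1 c' χ j (n : ℝ)‖ ≤ |C₁| * (ell D ^ 7)⁻¹ :=
        ((h₁' n).2.2.2 hwin).trans (mul_le_mul_of_nonneg_right (le_abs_self _) (by positivity))
      have h1 : ‖mSum13 c' χ j n - 500 * deriv χ.LFunction 1 / Real.log (bigP D) *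
          (-1 - betaJ c' D j * (Real.log (n / bigP D ^ (0.5 : ℝ)) : ℂ))‖ ≤
          |C₁| * (ell D ^ 7)⁻¹ + A := by
        rw [mSum13_eq_frakv1 c' χ hL3 j hlo]
        exact (norm_sub_le _ _).trans (add_le_add hv hm₁)
      have := norm_sum_divisors_le c' χ j hn0 (mSum13 c' χ j n) _ _ _ he₂0 (by positivity)
        hlP1pos h1 hm₁ hg hL' hN h2
      rw [hBe]
      exact this
  -- **summation over the range**
  set S := (Finset.Ico 1 (Nsupp D)).filter
      (fun n : ℕ => bigP D ^ (0.5 : ℝ) ≤ (n : ℝ) ∧ (n : ℝ) < bigP D ^ (0.502 : ℝ)) with hS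
  set w : ℕ → ℝ := fun n => ((n : ℝ) / Nat.totient n) ^ 7 / n with hw
  have hw0 : ∀ n, 0 ≤ w n := fun n => by rw [hw]; positivity
  -- weights of the good part and of the edge part
  have hWg : ∑ n ∈ S.filter good, w n ≤ Real.exp 256 * (2 + ell D ^ 9) := by
    refine le_trans (Finset.sum_le_sum_of_subset_of_nonneg ?_ fun n _ _ => hw0 n)
      (weight_good_le hL3)
    intro n hn
    rw [Finset.mem_filter] at hn
    obtain ⟨-, hg1, hg2⟩ := hn
    rw [Finset.mem_Ioc]
    exact ⟨(Nat.floor_lt hP5.le).mpr hg1, Nat.le_floor hg2⟩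
  have hWe : ∑ n ∈ S.filter (fun n => ¬ good n), w n ≤
      2 * Real.exp 256 + Real.exp 256 * (3 + ell D ^ 2) := by
    have hlo2 : (1 : ℝ) < bigP D ^ (0.5 : ℝ) := by
      have hP1' : 1 < bigP D := by
        have h9 : 0 < ell D ^ 9 := by positivity
        have := Real.add_one_lt_exp h9.ne'
        rw [bigP]; linarith
      exact Real.one_lt_rpow hP1' (by norm_num)
    set k : ℕ := ⌈bigP D ^ (0.5 : ℝ)⌉₊ with hk
    have hk2 : 2 ≤ k := by
      have : 1 < k := Nat.lt_ceil.mpr (by exact_mod_cast hlo2)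
      omega
    set A₁ := Finset.Ioc (k - 1) k with hA₁
    set B₁ := Finset.Ioc ⌊bigP D ^ (0.502 : ℝ) / bigT D⌋₊ ⌈bigP D ^ (0.502 : ℝ)⌉₊ with hB₁
    have hsub : S.filter (fun n => ¬ good n) ⊆ A₁ ∪ B₁ := by
      intro n hn
      rw [Finset.mem_filter, hS, Finset.mem_filter, Finset.mem_Ico] at hn
      obtain ⟨⟨⟨hn1, -⟩, hlo, hhi⟩, hng⟩ := hn
      rw [Finset.mem_union]
      rcases not_and_or.mp hng with h | h
      · left
        have heq : (n : ℝ) = bigP D ^ (0.5 : ℝ) := le_antisymm (not_lt.mp h) hlo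
        have hkn : k = n := by rw [hk, ← heq, Nat.ceil_natCast]
        rw [hA₁, Finset.mem_Ioc, hkn]
        omega
      · right
        rw [hB₁, Finset.mem_Ioc]
        refine ⟨(Nat.floor_lt (by positivity)).mpr (not_le.mp h), ?_⟩
        exact Nat.cast_le.mp ((hhi.le).trans (Nat.le_ceil _))
    have hAB := Finset.sum_union_inter (s₁ := A₁) (s₂ := B₁) (f := w)
    have hA := weight_point_le hk2
    have hB := weight_top_le (D := D) hL3
    have hI : 0 ≤ ∑ n ∈ A₁ ∩ B₁, w n := Finset.sum_nonneg fun n _ => hw0 n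
    calc ∑ n ∈ S.filter (fun n => ¬ good n), w n ≤ ∑ n ∈ A₁ ∪ B₁, w n :=
          Finset.sum_le_sum_of_subset_of_nonneg hsub fun n _ _ => hw0 n
      _ ≤ ∑ n ∈ A₁, w n + ∑ n ∈ B₁, w n := by linarith
      _ ≤ 2 * Real.exp 256 + Real.exp 256 * (3 + ell D ^ 2) := add_le_add hA hB
  -- assemble
  calc ‖∑ n ∈ S, ∑ r ∈ n.divisors, drWeight c' χ j (n / r) r *
          (mSum13 c' χ j n * nSum21 c' χ j (n / r) r -
            (500 * deriv χ.LFunction 1 / Real.log (bigP D) *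
                (-1 - betaJ c' D j * (Real.log (n / bigP D ^ (0.5 : ℝ)) : ℂ))) *
              (deriv χ.LFunction 1 * PiW χ (n / r) r *
                frakgW c' D j 6 (Skeleton.P1 D / (n : ℝ)) / (Real.log (Skeleton.P1 D) : ℂ)))‖
      ≤ ∑ n ∈ S, ‖∑ r ∈ n.divisors, drWeight c' χ j (n / r) r *
          (mSum13 c' χ j n * nSum21 c' χ j (n / r) r -
            (500 * deriv χ.LFunction 1 / Real.log (bigP D) *
                (-1 - betaJ c' D j * (Real.log (n / bigP D ^ (0.5 : ℝ)) : ℂ))) *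
              (deriv χ.LFunction 1 * PiW χ (n / r) r *
                frakgW c' D j 6 (Skeleton.P1 D / (n : ℝ)) / (Real.log (Skeleton.P1 D) : ℂ)))‖ :=
        norm_sum_le _ _
    _ ≤ ∑ n ∈ S, w n * (if good n then Bg else Be) := Finset.sum_le_sum key
    _ = ∑ n ∈ S.filter good, w n * Bg + ∑ n ∈ S.filter (fun n => ¬ good n), w n * Be := by
        simp_rw [mul_ite]
        rw [Finset.sum_ite]
    _ = Bg * ∑ n ∈ S.filter good, w n + Be * ∑ n ∈ S.filter (fun n => ¬ good n), w n := by
        rw [← Finset.sum_mul, ← Finset.sum_mul]; ring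
    _ ≤ Bg * (Real.exp 256 * (2 + ell D ^ 9)) +
          Be * (2 * Real.exp 256 + Real.exp 256 * (3 + ell D ^ 2)) := by
        gcongr
    _ ≤ Kg * (ell D ^ 12)⁻¹ / (0.504 * ell D ^ 9) * (Real.exp 256 * (2 + ell D ^ 9)) +
          Ke * (ell D ^ 3)⁻¹ / (0.504 * ell D ^ 9) *
            (2 * Real.exp 256 + Real.exp 256 * (3 + ell D ^ 2)) := by
        have hBg' : Bg ≤ Kg * (ell D ^ 12)⁻¹ / (0.504 * ell D ^ 9) := by
          rw [hBg, hlP1]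
          exact div_le_div_of_nonneg_right (coeff_good_le hL1 C₁ C₂) (by positivity)
        have hBe' : Be ≤ Ke * (ell D ^ 3)⁻¹ / (0.504 * ell D ^ 9) := by
          rw [hBe, hlP1]
          exact div_le_div_of_nonneg_right (coeff_edge_le hL1 C₁ C₂) (by positivity)
        gcongr
    _ ≤ ε * (π / ell D ^ 9) := final_le hL3 hKg0 hKe0 hε hLK
    _ = ε * alpha D := by rw [hα]

end Literature.NumberTheory.LFunctions.Zhang2022.Sj1321Mid
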